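import Summits.BirchSwinnertonDyer.BirchSwinnertonDyer.Theorems.CMKolyvaginAtInertTwoFrobeniusBridgeAtTwo
import HarnessLib

/-!
# Route `GenusKolyvaginAtTwo`, kernel item K₄ = `K4Neg` (stmt-BirchSwinnertonDyer-31526): the `FrobEqFrobInfty W K 2 ℓ` clause of K4Neg
# from the REGULAR-PAIR shape «a Frobenius at `ℓ` that is an involution of `E[2]` moving a `2`-torsion point and acting on `K` as a
# complex conjugation» — on `Δ < 0` with `ρ̄_{E,2}` onto the two are the same condition

Seat `bsd-line-gk2-p1` g23 (LEAD of the supply cruxes 23491 / 25504), `--supports stmt-BirchSwinnertonDyer-31526 --as helper` (closes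
nothing).  THEOREMS ONLY.  BSD is NOT proved by this; K4Neg is NOT closed.

WHY.  gk2-p5 g36's ℚ-side halving descent (B2Q♭, `…KFourPosHalvingDescent*`) produces, on the depth-one K₄/K₄⁺ cells and modulo Q2, a
Kolyvagin prime `ℓ` and a compatible datum with `P(ℓ) ∉ 2E(K[ℓ])`, the prime being delivered in the shape of the regular signed
pair-Čebotarev supply `hPair`: some arithmetic Frobenius `h` at a prime above `ℓ` and some complex conjugation `c₀` with `h² = 1` on
`E[2^{n+1}]`, `h` MOVING a point of `E[2]`, and `h = c₀` on `K`.  K4Neg's prime clause is Gross's (3.2) at level `2`,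
`FrobEqFrobInfty W K 2 ℓ` (`h = c₀` on `E[2]` AND on `K` for one pair `(h, c₀)`).  This file proves the former implies the latter when
`Δ(E) < 0` and `ρ̄_{E,2}` is onto — so K4Neg at depth one follows VERBATIM from the descent by post-composition, with no re-threading:

* `frobEqFrobInfty_two_of_involution_of_smul_ne` — the level-`2` statement;
* `frobEqFrobInfty_two_of_regularPair_clause` — the same from the literal `∃`-clause of `hPair`'s conclusion (involution on `E[2^{n+1}]`).

PROOF.  On `Δ < 0` a complex conjugation `c₀` is itself a transposition of `E[2]` (`c₀² = 1`, and it moves a `2`-torsion point: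
`KolyvaginEigenTwo.exists_twoTorsion_smul_ne_of_Δ_neg`); two transpositions of the `4`-group `E[2]` are conjugate under `Aut E[2] = ρ̄_{E,2}(Γ_ℚ)`
(`KolyvaginFrobeniusTwo.exists_conj_smul_eq_of_transpositions_two`), so `h' := g h g⁻¹ = c₀` on `E[2]` for some `g ∈ Γ_ℚ`; `h'` is an
arithmetic Frobenius at `g • 𝔓` (`IsArithFrobAt.conj`); and on `K` (quadratic, so `Gal(K/ℚ)` has two elements) `h' ≡ h ≡ c₀` — the
bookkeeping of cmk2-p1 g3's `KolyvaginFrobeniusTwo.frobEqFrobInfty_two_of_not_isSquare`, from which this proof is adapted.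

References: [GrossLMS1991] §3 (3.2)–(3.3); [McCallumLMS1991] §3 Cor. 3.2; [SilvermanAEC2009] III.6.4(b).
-/

set_option autoImplicit false
-- the Theorems namespace of this sub repeats the summit name by design (D-0017 nested layout)
set_option linter.dupNamespace false

noncomputable section

open scoped Classical Pointwise

namespace Summit.BirchSwinnertonDyer.BirchSwinnertonDyer.Theorems.GenusSupplyNarrow.FrobMatch

open WeierstrassCurve Field Function NumberField IsDedekindDomain Rat.HeightOneSpectrum
open Literature.NumberTheory.EllipticCurves Literature.NumberTheory.GaloisRepresentations
open Summit.BirchSwinnertonDyer.Rank1Residual.X11b.Three.Koly.Method2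
open Summit.BirchSwinnertonDyer.Rank1Residual.JET
open Summit.BirchSwinnertonDyer.BirchSwinnertonDyer.Theorems.KolyvaginEigenTwo
open Summit.BirchSwinnertonDyer.BirchSwinnertonDyer.Theorems.KolyvaginFrobeniusTwo

variable (W : WeierstrassCurve ℚ) [W.IsElliptic] (K : Type) [Field K] [NumberField K]

/-- **Gross's (3.2) at level `2` from an involutive Frobenius moving a `2`-torsion point (`Δ < 0`, `ρ̄_{E,2}` onto).**  For `W/ℚ` with
`Δ(W) < 0` and `ρ̄_{W,2}` onto, `K` imaginary quadratic, a prime `v ∋ ℓ` of `ℚ`, a prime `𝔓 ∣ v` of `\bar ℤ`, an arithmetic Frobenius `h`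
at `𝔓` with `h² = 1` on `E[2]` and `h • u ≠ u` for some `u ∈ E[2]`, and a complex conjugation `c₀` with `h = c₀` on `K` (through every
embedding): `FrobEqFrobInfty W K 2 ℓ`.  (Conjugate `h` into `c₀` on `E[2]` inside `ρ̄_{W,2}(Γ_ℚ) = Aut E[2]`; the conjugate is a Frobenius
at `g • 𝔓` and agrees with `h`, hence with `c₀`, on the quadratic field `K`.)
Adapted from `KolyvaginFrobeniusTwo.frobEqFrobInfty_two_of_not_isSquare` (cmk2-p1 g3). [cite: GrossLMS1991, §3 (3.2)–(3.3)]
[cite: McCallumLMS1991, §3 Cor. 3.2] -/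
theorem frobEqFrobInfty_two_of_involution_of_smul_ne (hK : IsImaginaryQuadratic K)
    (hsurj : W.HasSurjectiveModNGaloisRep 2) (hΔ : W.Δ < 0) {ℓ : ℕ}
    {v : HeightOneSpectrum (𝓞 ℚ)} {𝔓 : Ideal (absIntegers (𝓞 ℚ) ℚ)} {h c₀ : absoluteGaloisGroup ℚ}
    (hℓv : (ℓ : 𝓞 ℚ) ∈ v.asIdeal) (h𝔓 : 𝔓 ∈ v.primesAbove) (hh : IsArithFrobAt (𝓞 ℚ) h 𝔓)
    (hc₀ : IsComplexConjugation (Rat.castHom ℝ) c₀)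
    (hinv : ∀ X : geomTorsion W ((2 : ℕ) : ℤ), h • h • X = X)
    (hmove : ∃ u : geomTorsion W ((2 : ℕ) : ℤ), h • u ≠ u)
    (hhK : ∀ (e : K →ₐ[ℚ] AlgebraicClosure ℚ) (z : K), h • e z = c₀ • e z) :
    FrobEqFrobInfty W K 2 ℓ := by
  haveI : Algebra.IsQuadraticExtension ℚ K := ⟨hK.1⟩
  obtain ⟨u, hu⟩ := hmove
  have hC2 : ∀ P : geomTorsion W ((2 : ℕ) : ℤ), c₀ • c₀ • P = P := fun P ↦ by
    rw [← mul_smul, ← sq, hc₀.sq_eq_one, one_smul]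
  obtain ⟨u', hu'⟩ : ∃ u' : geomTorsion W ((2 : ℕ) : ℤ), c₀ • u' ≠ u' :=
    exists_twoTorsion_smul_ne_of_Δ_neg W hΔ hc₀
  -- ### conjugate `h` into `c₀` on `E[2]`
  have hsurj' : W.HasSurjectiveModNGaloisRep ((2 : ℕ) : ℤ) := by simpa using hsurj
  obtain ⟨g, hg⟩ := exists_conj_smul_eq_of_transpositions_two W hsurj' hinv hu hC2 hu'
  set h' := g * h * g⁻¹ with hh'def
  have hhP : ∀ P : geomTorsion W ((2 : ℕ) : ℤ), h' • P = c₀ • P := fun P ↦ by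
    rw [hh'def, mul_smul, mul_smul]; exact hg P
  have hhFrob : IsArithFrobAt (𝓞 ℚ) h' (g • 𝔓) := hh.conj g
  -- ### on `K`: `h' ≡ h ≡ c₀` (the restriction `Γ_ℚ → Gal(K/ℚ)`, a group with two elements)
  letI : Algebra K (AlgebraicClosure ℚ) := (absEmbedding ℚ K).toRingHom.toAlgebra
  haveI : IsScalarTower ℚ K (AlgebraicClosure ℚ) :=
    IsScalarTower.of_algebraMap_eq fun r ↦ ((absEmbedding ℚ K).commutes r).symm
  let r : absoluteGaloisGroup ℚ →* (K ≃ₐ[ℚ] K) :=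
    (AlgEquiv.restrictNormalHom K).comp (absoluteGaloisGroup.toAlgEquiv ℚ).toMonoidHom
  have hr : ∀ (σ : absoluteGaloisGroup ℚ) (x : K), σ • absEmbedding ℚ K x = absEmbedding ℚ K (r σ x) :=
    fun σ x ↦ by
    have := AlgEquiv.restrictNormal_commutes (absoluteGaloisGroup.toAlgEquiv ℚ σ) K x
    rw [absoluteGaloisGroup.smul_def]
    exact this.symm
  have hrange : ∀ σ : absoluteGaloisGroup ℚ, r σ = 1 → σ ∈ (absGaloisRestrict ℚ K).range := by
    intro σ hσ
    rw [mem_range_absGaloisRestrict_iff_smul_absEmbedding]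
    intro x
    rw [hr, hσ, AlgEquiv.one_apply]
  have hrhc : r h = r c₀ := by
    ext x
    apply (absEmbedding ℚ K).toRingHom.injective
    change absEmbedding ℚ K (r h x) = absEmbedding ℚ K (r c₀ x)
    rw [← hr, ← hr]
    exact hhK (absEmbedding ℚ K) x
  have hrc₀ : r c₀ ≠ 1 := fun h1 ↦
    Rat.not_mem_range_absGaloisRestrict_of_isComplexConjugation K hK.2 hc₀ (hrange c₀ h1)
  have hcard : Nat.card (K ≃ₐ[ℚ] K) = 2 := by rw [IsGalois.card_aut_eq_finrank, hK.1]
  obtain ⟨y, -, hy⟩ := (Nat.card_eq_two_iff' (1 : K ≃ₐ[ℚ] K)).mp hcard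
  have hrh' : r h' = r c₀ := by
    rw [hh'def, map_mul, map_mul, map_inv, hrhc]
    by_cases hrg : r g = 1
    · rw [hrg, one_mul, inv_one, mul_one]
    · rw [hy _ hrg, hy _ hrc₀, mul_inv_cancel_right]
  have hmem : c₀⁻¹ * h' ∈ (absGaloisRestrict ℚ K).range := by
    refine hrange _ ?_
    rw [map_mul, map_inv, hrh', inv_mul_cancel]
  obtain ⟨τ, hτ⟩ := MonoidHom.mem_range.mp hmem
  have hτ' : absGaloisRestrict ℚ K τ = c₀⁻¹ * h' := hτ
  -- ### assemble (3.2)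
  refine ⟨v, g • 𝔓, h', c₀, hℓv, smul_mem_primesAbove h𝔓 g, hhFrob, hc₀, hhP, fun e x ↦ ?_⟩
  have hh'' : h' = c₀ * absGaloisRestrict ℚ K τ := by rw [hτ', mul_inv_cancel_left]
  rw [hh'', mul_smul, absGaloisRestrict_smul_apply_eq τ e x]

omit [W.IsElliptic] in
/-- An involution of `E[2^{n+1}]` is an involution of `E[2] ⊆ E[2^{n+1}]`. [folklore] -/
theorem smul_smul_twoTorsion_eq_self_of_level {n : ℕ} {h : absoluteGaloisGroup ℚ}
    (hinv : ∀ X : geomTorsion W ((2 ^ (n + 1) : ℕ) : ℤ), h • h • X = X) (X : geomTorsion W ((2 : ℕ) : ℤ)) :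
    h • h • X = X := by
  have hX : (X : geomPoints W) ∈ geomTorsion W ((2 ^ (n + 1) : ℕ) : ℤ) :=
    geomTorsion_le_of_dvd W (by exact_mod_cast dvd_pow_self 2 (Nat.succ_ne_zero n)) X.2
  have h1 := congrArg Subtype.val (hinv ⟨X, hX⟩)
  simp only [Literature.NumberTheory.EllipticCurves.AddSubgroup.torsionBy.coe_smul] at h1
  apply Subtype.ext
  simp only [Literature.NumberTheory.EllipticCurves.AddSubgroup.torsionBy.coe_smul]
  exact h1

/-- **K4Neg's prime clause from the regular-pair clause.**  For `W/ℚ` with `Δ(W) < 0` and `ρ̄_{W,2}` onto and `K` imaginary quadratic, the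
literal Frobenius clause in the conclusion of the regular signed pair-Čebotarev supply `hPair` (gk2-p5 g31 `PlusDescent.regularPairSupply_of_Δ_neg`,
consumed by the B2Q♭ halving descent) — an arithmetic Frobenius `h` above `ℓ` and a complex conjugation `c₀` with `h² = 1` on `E[2^{n+1}]`,
`h` moving a point of `E[2]`, `h = c₀` on `K` — implies `FrobEqFrobInfty W K 2 ℓ`, the prime clause of K4Neg (31526).  So K4Neg at depth one
follows from the ℚ-side descent by post-composition. [cite: GrossLMS1991, §3 (3.2)] [cite: McCallumLMS1991, §3 Cor. 3.2] -/
theorem frobEqFrobInfty_two_of_regularPair_clause (hK : IsImaginaryQuadratic K)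
    (hsurj : W.HasSurjectiveModNGaloisRep 2) (hΔ : W.Δ < 0) {ℓ n : ℕ}
    (hF : ∃ (v : HeightOneSpectrum (𝓞 ℚ)) (𝔓 : Ideal (absIntegers (𝓞 ℚ) ℚ)) (h c₀ : absoluteGaloisGroup ℚ),
      (ℓ : 𝓞 ℚ) ∈ v.asIdeal ∧ 𝔓 ∈ v.primesAbove ∧ IsArithFrobAt (𝓞 ℚ) h 𝔓 ∧ IsComplexConjugation (Rat.castHom ℝ) c₀ ∧
      (∀ X : geomTorsion W ((2 ^ (n + 1) : ℕ) : ℤ), h • h • X = X) ∧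
      (∃ u : geomTorsion W ((2 : ℕ) : ℤ), h • u ≠ u) ∧
      ∀ (e : K →ₐ[ℚ] AlgebraicClosure ℚ) (z : K), h • e z = c₀ • e z) :
    FrobEqFrobInfty W K 2 ℓ := by
  obtain ⟨v, 𝔓, h, c₀, hℓv, h𝔓, hh, hc₀, hinv, hmove, hhK⟩ := hF
  exact frobEqFrobInfty_two_of_involution_of_smul_ne W K hK hsurj hΔ hℓv h𝔓 hh hc₀
    (smul_smul_twoTorsion_eq_self_of_level W hinv) hmove hhK

end Summit.BirchSwinnertonDyer.BirchSwinnertonDyer.Theorems.GenusSupplyNarrow.FrobMatch
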